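import Mathlib

/-!
# SoloBlind — D17a: the one-dimensional lattice resolvent in closed form

Soloist seat `solo-QuantumFields-blind` (session s23).  Kernel support for rung D17 of the seat's
infrared-zero chain (`SoloBlindMaxwellCovariance`): the Fourier coefficients of the resolvent of
the one-dimensional lattice Laplacian,

  `axisResolvent a n = ∫_{-π}^{π} cos (n θ) / (a - cos θ) dθ`,   `a > 1`,

are computed in closed form WITHOUT contour integration or Fourier theory:

  `axisResolvent a n = (2π / √(a² - 1)) · r(a)ⁿ`,   `r(a) = a - √(a² - 1) ∈ (0, 1)`

(`r(a) = e^{-λ}` with `cosh λ = a`: the transfer-matrix decay of the free lattice propagator in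
one direction).  Proof: the product formula `cos((n+2)θ) + cos(nθ) = 2 cos((n+1)θ) cos θ` gives
the three-term recurrence `R(n+2) + R(n) = 2a R(n+1)` and `R(1) = a R(0) - 2π`; the sequence is
bounded by `R(0)` (`|cos| ≤ 1`), so the growing mode `r⁻ⁿ` of the recurrence is absent
(`D(n) := R(n+1) - r R(n)` satisfies `D(0) = rⁿ D(n)` with `D` bounded, hence `D ≡ 0`), and the
boundary relation fixes `R(0) = 2π / (a - r) = 2π / √(a² - 1)`.

Also recorded: positivity, monotonicity in `a` and continuity of the decay ratio `r(a)`, and the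
`axisKernel n a = π r(a)ⁿ / √(a² - 1)` (`= R(n)/2`) with its antitonicity in `a > 1` — the form
in which `SoloBlindMaxwellCovariance` uses the result (the plaquette covariance of lattice Maxwell
theory along a lattice axis is a positive mixture of the kernels `axisKernel n (1 + E/2)` over
the spatial momenta, `E` the spatial lattice energy).  Standard material (lattice propagator in
the transfer-matrix / spectral representation); no summit claim is made in this file.
-/

open Real MeasureTheory Set Filter intervalIntegral

noncomputable section

namespace Summit.QuantumFields.YangMills.Theorems.SoloBlind

/-! ### Definitions -/

/-- The Fourier coefficients of the one-dimensional lattice resolvent: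
`axisResolvent a n = ∫_{-π}^{π} cos (n θ) / (a - cos θ) dθ` (meaningful for `a > 1`). -/
def axisResolvent (a : ℝ) (n : ℕ) : ℝ :=
  ∫ θ in (-π)..π, Real.cos ((n : ℝ) * θ) / (a - Real.cos θ)

/-- The decay ratio `r(a) = a - √(a² - 1)` of the one-dimensional lattice resolvent
(`r = e^{-λ}` with `cosh λ = a`; for `a ≥ 1`, `r(a) = 1 / (a + √(a² - 1)) ∈ (0, 1]`). -/
def decayRatio (a : ℝ) : ℝ := a - Real.sqrt (a ^ 2 - 1)

/-- The axis kernel `π r(a)ⁿ / √(a² - 1)` — one half of `axisResolvent a n` for `a > 1`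
(`axisResolvent_eq`); at `a = 1` it takes the junk value `0` (`√0 = 0`, `x / 0 = 0`). -/
def axisKernel (n : ℕ) (a : ℝ) : ℝ := π * decayRatio a ^ n / Real.sqrt (a ^ 2 - 1)

/-! ### The decay ratio -/

/-- `decayRatio 1 = 1`. -/
theorem decayRatio_one : decayRatio 1 = 1 := by simp [decayRatio]

/-- `decayRatio` is continuous. -/
theorem continuous_decayRatio : Continuous decayRatio := by
  unfold decayRatio; fun_prop

/-- For `a ≥ 1`: `r(a) · (a + √(a² - 1)) = 1`. -/
theorem decayRatio_mul_add_sqrt {a : ℝ} (ha : 1 ≤ a) :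
    decayRatio a * (a + Real.sqrt (a ^ 2 - 1)) = 1 := by
  have hs2 : Real.sqrt (a ^ 2 - 1) ^ 2 = a ^ 2 - 1 := Real.sq_sqrt (by nlinarith)
  unfold decayRatio
  nlinarith [hs2]

/-- For `a ≥ 1`: `r(a) = 1 / (a + √(a² - 1))`. -/
theorem decayRatio_eq_one_div {a : ℝ} (ha : 1 ≤ a) :
    decayRatio a = 1 / (a + Real.sqrt (a ^ 2 - 1)) := by
  have hpos : 0 < a + Real.sqrt (a ^ 2 - 1) := by positivity
  rw [eq_div_iff hpos.ne']
  exact decayRatio_mul_add_sqrt ha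

/-- For `a ≥ 1`: `0 < r(a)`. -/
theorem decayRatio_pos {a : ℝ} (ha : 1 ≤ a) : 0 < decayRatio a := by
  rw [decayRatio_eq_one_div ha]; positivity

/-- For `a ≥ 1`: `r(a) ≤ 1`. -/
theorem decayRatio_le_one {a : ℝ} (ha : 1 ≤ a) : decayRatio a ≤ 1 := by
  unfold decayRatio
  have : a - 1 ≤ Real.sqrt (a ^ 2 - 1) := by
    rw [Real.le_sqrt (by linarith) (by nlinarith)]
    nlinarith
  linarith

/-- For `a > 1`: `r(a) < 1`. -/
theorem decayRatio_lt_one {a : ℝ} (ha : 1 < a) : decayRatio a < 1 := by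
  unfold decayRatio
  have : a - 1 < Real.sqrt (a ^ 2 - 1) := by
    rw [Real.lt_sqrt (by linarith)]
    nlinarith
  linarith

/-- The decay ratio is non-increasing on `[1, ∞)`: `1 ≤ a ≤ b → r(b) ≤ r(a)`. -/
theorem decayRatio_antitone {a b : ℝ} (ha : 1 ≤ a) (hab : a ≤ b) :
    decayRatio b ≤ decayRatio a := by
  rw [decayRatio_eq_one_div ha, decayRatio_eq_one_div (ha.trans hab)]
  have hpos : 0 < a + Real.sqrt (a ^ 2 - 1) := by positivity
  apply one_div_le_one_div_of_le hpos
  have : Real.sqrt (a ^ 2 - 1) ≤ Real.sqrt (b ^ 2 - 1) :=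
    Real.sqrt_le_sqrt (by nlinarith)
  linarith

/-! ### The axis kernel -/

/-- For `a ≥ 1` the axis kernel is non-negative. -/
theorem axisKernel_nonneg (n : ℕ) {a : ℝ} (ha : 1 ≤ a) : 0 ≤ axisKernel n a := by
  unfold axisKernel
  have := (decayRatio_pos ha).le
  positivity

/-- For `a > 1` the axis kernel is positive. -/
theorem axisKernel_pos (n : ℕ) {a : ℝ} (ha : 1 < a) : 0 < axisKernel n a := by
  unfold axisKernel
  have h1 := decayRatio_pos ha.le
  have h2 : 0 < Real.sqrt (a ^ 2 - 1) := Real.sqrt_pos.2 (by nlinarith)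
  positivity

/-- The axis kernel is non-increasing in `a` on `(1, ∞)`:
`1 < a ≤ b → axisKernel n b ≤ axisKernel n a` (both factors `r(a)ⁿ` and `1/√(a² - 1)` are
positive and non-increasing). -/
theorem axisKernel_antitone (n : ℕ) {a b : ℝ} (ha : 1 < a) (hab : a ≤ b) :
    axisKernel n b ≤ axisKernel n a := by
  unfold axisKernel
  have hsa : 0 < Real.sqrt (a ^ 2 - 1) := Real.sqrt_pos.2 (by nlinarith)
  have hsab : Real.sqrt (a ^ 2 - 1) ≤ Real.sqrt (b ^ 2 - 1) := Real.sqrt_le_sqrt (by nlinarith)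
  have hra : 0 ≤ decayRatio b := (decayRatio_pos (ha.le.trans hab)).le
  have hrn : decayRatio b ^ n ≤ decayRatio a ^ n :=
    pow_le_pow_left₀ hra (decayRatio_antitone ha.le hab) n
  rw [mul_div_assoc, mul_div_assoc]
  refine mul_le_mul_of_nonneg_left ?_ pi_pos.le
  rw [div_le_div_iff₀ (hsa.trans_le hsab) hsa]
  exact mul_le_mul hrn hsab hsa.le (pow_nonneg (decayRatio_pos ha.le).le n)

/-- A lower bound for the axis kernel by a pure exponential: if `q ≤ r(a)` with `q ≥ 0`, then
`π qⁿ / √(a² - 1) ≤ axisKernel n a`. -/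
theorem axisKernel_ge_of_le_decayRatio (n : ℕ) {a q : ℝ} (ha : 1 < a) (hq : 0 ≤ q)
    (hqr : q ≤ decayRatio a) : π * q ^ n / Real.sqrt (a ^ 2 - 1) ≤ axisKernel n a := by
  unfold axisKernel
  have hsa : 0 < Real.sqrt (a ^ 2 - 1) := Real.sqrt_pos.2 (by nlinarith)
  exact div_le_div_of_nonneg_right (mul_le_mul_of_nonneg_left (pow_le_pow_left₀ hq hqr n)
    pi_pos.le) hsa.le

/-! ### The integrand -/

/-- For `a > 1` the integrand `cos (n θ) / (a - cos θ)` is continuous. -/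
theorem continuous_axisIntegrand {a : ℝ} (ha : 1 < a) (n : ℕ) :
    Continuous fun θ : ℝ => Real.cos ((n : ℝ) * θ) / (a - Real.cos θ) :=
  Continuous.div (by fun_prop) (by fun_prop) fun θ =>
    (show 0 < a - Real.cos θ by linarith [Real.cos_le_one θ]).ne'

/-- `∫_{-π}^{π} cos (k θ) dθ = 0` for a natural number `k ≠ 0`. -/
theorem integral_cos_nat_mul_eq_zero {k : ℕ} (hk : k ≠ 0) :
    ∫ θ in (-π)..π, Real.cos ((k : ℝ) * θ) = 0 := by
  have hk' : (k : ℝ) ≠ 0 := Nat.cast_ne_zero.2 hk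
  rw [intervalIntegral.integral_comp_mul_left (fun x => Real.cos x) hk', integral_cos]
  simp [mul_neg, Real.sin_neg, Real.sin_nat_mul_pi]

/-! ### Positivity and boundedness -/

/-- `axisResolvent a 0 = ∫_{-π}^{π} dθ / (a - cos θ)`. -/
theorem axisResolvent_zero (a : ℝ) :
    axisResolvent a 0 = ∫ θ in (-π)..π, 1 / (a - Real.cos θ) := by
  simp [axisResolvent]

/-- For `a > 1`: `0 < axisResolvent a 0`. -/
theorem axisResolvent_zero_pos {a : ℝ} (ha : 1 < a) : 0 < axisResolvent a 0 := by
  rw [axisResolvent_zero]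
  refine intervalIntegral_pos_of_pos_on ?_ (fun θ _ => div_pos one_pos
    (show 0 < a - Real.cos θ by linarith [Real.cos_le_one θ]))
    (by linarith [pi_pos])
  exact (Continuous.div continuous_const (by fun_prop) fun θ =>
    (show 0 < a - Real.cos θ by linarith [Real.cos_le_one θ]).ne').intervalIntegrable _ _

/-- For `a > 1`: `|axisResolvent a n| ≤ axisResolvent a 0` (since `|cos (n θ)| ≤ 1`). -/
theorem abs_axisResolvent_le {a : ℝ} (ha : 1 < a) (n : ℕ) :
    |axisResolvent a n| ≤ axisResolvent a 0 := by
  have hπ : -π ≤ π := by linarith [pi_pos]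
  unfold axisResolvent
  refine (abs_integral_le_integral_abs hπ).trans ?_
  refine integral_mono_on hπ ((continuous_axisIntegrand ha n).abs.intervalIntegrable _ _)
    ((continuous_axisIntegrand ha 0).intervalIntegrable _ _) fun θ _ => ?_
  have hd : 0 < a - Real.cos θ := by linarith [Real.cos_le_one θ]
  rw [abs_div, abs_of_pos hd]
  refine div_le_div_of_nonneg_right ?_ hd.le
  simpa using Real.abs_cos_le_one ((n : ℝ) * θ)

/-! ### The recurrence -/

/-- The three-term recurrence `R(n+2) + R(n) = 2a R(n+1)` (`a > 1`), from
`cos((n+2)θ) + cos(nθ) = 2 cos((n+1)θ) cos θ` and `∫_{-π}^{π} cos((n+1)θ) dθ = 0`. -/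
theorem axisResolvent_succ_succ {a : ℝ} (ha : 1 < a) (n : ℕ) :
    axisResolvent a (n + 2) + axisResolvent a n = 2 * a * axisResolvent a (n + 1) := by
  have hpt : ∀ θ : ℝ, Real.cos (((n + 2 : ℕ) : ℝ) * θ) / (a - Real.cos θ) +
      Real.cos ((n : ℝ) * θ) / (a - Real.cos θ) =
      2 * a * (Real.cos (((n + 1 : ℕ) : ℝ) * θ) / (a - Real.cos θ)) -
        2 * Real.cos (((n + 1 : ℕ) : ℝ) * θ) := by
    intro θ
    have hd := (show 0 < a - Real.cos θ by linarith [Real.cos_le_one θ]).ne'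
    have hc : Real.cos (((n + 2 : ℕ) : ℝ) * θ) + Real.cos ((n : ℝ) * θ) =
        2 * Real.cos (((n + 1 : ℕ) : ℝ) * θ) * Real.cos θ := by
      have h1 : (((n + 2 : ℕ) : ℝ) * θ) = ((n + 1 : ℕ) : ℝ) * θ + θ := by push_cast; ring
      have h2 : ((n : ℝ) * θ) = ((n + 1 : ℕ) : ℝ) * θ - θ := by push_cast; ring
      rw [h1, h2, Real.cos_add, Real.cos_sub]; ring
    rw [← add_div, hc]
    field_simp
    ring
  have hi := fun k => (continuous_axisIntegrand ha k).intervalIntegrable (μ := volume) (-π) π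
  unfold axisResolvent
  rw [← integral_add (hi (n + 2)) (hi n), integral_congr fun θ _ => hpt θ,
    integral_sub ((hi (n + 1)).const_mul (2 * a)) (by exact (by fun_prop :
      Continuous fun θ : ℝ => 2 * Real.cos (((n + 1 : ℕ) : ℝ) * θ)).intervalIntegrable _ _),
    intervalIntegral.integral_const_mul, intervalIntegral.integral_const_mul,
    integral_cos_nat_mul_eq_zero (Nat.succ_ne_zero n)]
  ring

/-- The boundary relation `R(1) = a R(0) - 2π` (`a > 1`), from
`cos θ/(a - cos θ) = a/(a - cos θ) - 1`. -/
theorem axisResolvent_one {a : ℝ} (ha : 1 < a) :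
    axisResolvent a 1 = a * axisResolvent a 0 - 2 * π := by
  have hpt : ∀ θ : ℝ, Real.cos (((1 : ℕ) : ℝ) * θ) / (a - Real.cos θ) =
      a * (Real.cos (((0 : ℕ) : ℝ) * θ) / (a - Real.cos θ)) - 1 := by
    intro θ
    have hd := (show 0 < a - Real.cos θ by linarith [Real.cos_le_one θ]).ne'
    simp only [Nat.cast_one, one_mul, Nat.cast_zero, zero_mul, Real.cos_zero]
    field_simp
    ring
  have hi := fun k => (continuous_axisIntegrand ha k).intervalIntegrable (μ := volume) (-π) π
  unfold axisResolvent
  rw [integral_congr fun θ _ => hpt θ, integral_sub ((hi 0).const_mul a)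
    (by exact intervalIntegrable_const), intervalIntegral.integral_const_mul,
    intervalIntegral.integral_const]
  simp; ring

/-! ### Solving the recurrence -/

/-- The decay ratio solves the characteristic equation in the form used below:
`r · (2a - r) = 1` (`a ≥ 1`). -/
theorem decayRatio_mul_two_mul_sub {a : ℝ} (ha : 1 ≤ a) :
    decayRatio a * (2 * a - decayRatio a) = 1 := by
  have := decayRatio_mul_add_sqrt ha
  unfold decayRatio at this ⊢
  linarith

/-- **The growing mode is absent.** For `a > 1` and every `n`:
`axisResolvent a (n+1) = r(a) · axisResolvent a n`. -/
theorem axisResolvent_succ {a : ℝ} (ha : 1 < a) (n : ℕ) :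
    axisResolvent a (n + 1) = decayRatio a * axisResolvent a n := by
  set r := decayRatio a with hr
  have hr0 : 0 < r := decayRatio_pos ha.le
  have hr1 : r < 1 := decayRatio_lt_one ha
  -- `D n := R(n+1) - r R(n)` satisfies `D n = r · D (n+1)`
  set D : ℕ → ℝ := fun k => axisResolvent a (k + 1) - r * axisResolvent a k with hD
  have hstep : ∀ k, D k = r * D (k + 1) := by
    intro k
    simp only [hD]
    have hrec := axisResolvent_succ_succ ha k
    have hchar := decayRatio_mul_two_mul_sub ha.le
    rw [← hr] at hchar
    have : axisResolvent a (k + 2) = 2 * a * axisResolvent a (k + 1) - axisResolvent a k := by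
      linarith
    rw [show k + 1 + 1 = k + 2 from rfl, this]
    linear_combination (-(axisResolvent a (k + 1))) * hchar
  have hiter : ∀ k, D 0 = r ^ k * D k := by
    intro k
    induction k with
    | zero => simp
    | succ k ih => rw [ih, hstep k, pow_succ]; ring
  -- `D` is bounded by `2 R(0)`
  have hR0 := axisResolvent_zero_pos ha
  have hbound : ∀ k, |D k| ≤ 2 * axisResolvent a 0 := by
    intro k
    simp only [hD]
    have h1 := abs_axisResolvent_le ha (k + 1)
    have h2 := abs_axisResolvent_le ha k
    calc |axisResolvent a (k + 1) - r * axisResolvent a k|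
        ≤ |axisResolvent a (k + 1)| + |r * axisResolvent a k| := abs_sub _ _
      _ = |axisResolvent a (k + 1)| + r * |axisResolvent a k| := by
          rw [abs_mul, abs_of_pos hr0]
      _ ≤ axisResolvent a 0 + 1 * axisResolvent a 0 := by
          gcongr
      _ = 2 * axisResolvent a 0 := by ring
  -- hence `D 0 = 0`
  have hD0 : D 0 = 0 := by
    by_contra hne
    have hpos : 0 < |D 0| := abs_pos.2 hne
    obtain ⟨k, hk⟩ := exists_pow_lt_of_lt_one
      (div_pos hpos (by linarith : (0 : ℝ) < 2 * axisResolvent a 0 + 1)) hr1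
    have : |D 0| < |D 0| :=
      calc |D 0| = r ^ k * |D k| := by rw [hiter k, abs_mul, abs_of_pos (pow_pos hr0 k)]
        _ ≤ r ^ k * (2 * axisResolvent a 0 + 1) :=
            mul_le_mul_of_nonneg_left ((hbound k).trans (by linarith)) (pow_pos hr0 k).le
        _ < |D 0| / (2 * axisResolvent a 0 + 1) * (2 * axisResolvent a 0 + 1) :=
            mul_lt_mul_of_pos_right hk (by linarith)
        _ = |D 0| := div_mul_cancel₀ _ (by linarith)
    exact lt_irrefl _ this
  -- and `D n = 0`
  have hDn : D n = 0 := by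
    have := hiter n
    rw [hD0] at this
    exact (mul_eq_zero.1 this.symm).resolve_left (pow_ne_zero n hr0.ne')
  simp only [hD] at hDn
  linarith

/-- **The value at zero.** For `a > 1`: `axisResolvent a 0 = 2π / √(a² - 1)`. -/
theorem axisResolvent_zero_eq {a : ℝ} (ha : 1 < a) :
    axisResolvent a 0 = 2 * π / Real.sqrt (a ^ 2 - 1) := by
  have hs : 0 < Real.sqrt (a ^ 2 - 1) := Real.sqrt_pos.2 (by nlinarith)
  have h1 := axisResolvent_succ ha 0
  rw [zero_add, axisResolvent_one ha] at h1
  -- `(a - r) R(0) = 2π` and `a - r = √(a² - 1)`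
  have har : a - decayRatio a = Real.sqrt (a ^ 2 - 1) := by unfold decayRatio; ring
  rw [eq_div_iff hs.ne', ← har]
  linarith

/-- **Closed form.** For `a > 1` and every `n`:
`∫_{-π}^{π} cos (n θ) / (a - cos θ) dθ = (2π / √(a² - 1)) · (a - √(a² - 1))ⁿ`. -/
theorem axisResolvent_eq {a : ℝ} (ha : 1 < a) (n : ℕ) :
    axisResolvent a n = 2 * π / Real.sqrt (a ^ 2 - 1) * decayRatio a ^ n := by
  induction n with
  | zero => rw [axisResolvent_zero_eq ha, pow_zero, mul_one]
  | succ n ih => rw [axisResolvent_succ ha n, ih, pow_succ]; ring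

/-- The closed form in kernel shape: `axisResolvent a n = 2 · axisKernel n a` (`a > 1`). -/
theorem axisResolvent_eq_two_mul_axisKernel {a : ℝ} (ha : 1 < a) (n : ℕ) :
    axisResolvent a n = 2 * axisKernel n a := by
  rw [axisResolvent_eq ha n, axisKernel]; ring

/-- For `a > 1`: every coefficient is positive, `0 < axisResolvent a n`. -/
theorem axisResolvent_pos {a : ℝ} (ha : 1 < a) (n : ℕ) : 0 < axisResolvent a n := by
  rw [axisResolvent_eq_two_mul_axisKernel ha n]
  exact mul_pos two_pos (axisKernel_pos n ha)

end Summit.QuantumFields.YangMills.Theorems.SoloBlind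

end
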